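import Mathlib
import Summits.KontsevichZagierPeriods.Zeta5Search.RayFaceKitCover
import Summits.KontsevichZagierPeriods.Zeta5Search.RecordCellAAtlas
import HarnessLib

/-!
# ζ(5) search — RAY FACE KIT, record-ray instance: checked face certificates are class-type covers of `b(n) = n·(41; 17,…,11)` (p3 g7)

HONEST FRAMING: systematic search; no irrationality claim unless certified.  Cell `pub-zeta5`, prover seat p3, generation 7.
Integer bookkeeping of net exponents; every kernel exponent the consumers feed stays `< 1` — no irrationality content; nothing
about `ζ(5)`.

P1 g14's `RayFaceKit.cover_of_faceCheck` (file II `RayFaceKitCover`) is stated for ANY ray with block-form net exponents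
`1 − #{j < J : lo_j n ≤ q ≤ hi_j n} + [2q = B₀ n]`.  Brown–Zudilin's record ray has this form with `B₀ = 41`, `J = 7`,
`lo = (17,16,15,14,13,12,11)`, `hi = (24,25,26,27,28,29,30)` (`RecordCellAAtlas.netExp_bRec` / `dep7`).  This file is the
one-screen instance: `recLos`, `recHis`, `blockSum_rec` (the kit's indicator sum is `dep7`), `netExp_rec`, and
**`rec_cover : faceCheck 41 7 recLos recHis c = true → c.win.Holds n p → Cover (bRec n) p (coverOf 7 c)`** — so a record-ray
LETTERS window (p3 g6's `RecordLetters*` shape, THEOREM LB + Lemma-D / double-drop / collinearity / law-A3 bonuses through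
`RecordRayLevels.record_*`) is certified by two `FaceCert` literals and `decide +kernel` instead of level-by-level `omega` files;
the kit rows feed the record ray's table (`RecordRayDenominatorsBricksClassK`, kind 5, any shift `m`).
-/

namespace Summit.KontsevichZagierPeriods.Zeta5Search.RecordRayFaceKit

open Finset
open Summit.KontsevichZagierPeriods.Zeta5Search.RayFaceKit
open Summit.KontsevichZagierPeriods.Zeta5Search.ClusterValuation (bRec netExp)
open Summit.KontsevichZagierPeriods.Zeta5Search.ClassTypeCover (Cover)
open Summit.KontsevichZagierPeriods.Zeta5Search.CellA (dep7 netExp_bRec bRec_zero)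

/-- Lower block coefficients of the record ray: block `j` is `[lo_j n, hi_j n]` with `lo = (17, 16, …, 11)`. -/
def recLos : List ℕ := [17, 16, 15, 14, 13, 12, 11]

/-- Upper block coefficients of the record ray: `hi = 41 − lo = (24, 25, …, 30)`. -/
def recHis : List ℕ := [24, 25, 26, 27, 28, 29, 30]

/-- The kit's block indicator sum on the record ray is `dep7`. -/
theorem blockSum_rec (n q : ℕ) : blockSum 7 recLos recHis n q = dep7 n q := by
  simp only [blockSum, recLos, recHis, dep7, sum_range_succ, sum_range_zero, zero_add]
  rfl

/-- Block form of the record ray's net exponents, in the kit's shape. -/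
theorem netExp_rec (n q : ℕ) :
    netExp (bRec n) q = 1 - (blockSum 7 recLos recHis n q : ℤ) + if 2 * q = 41 * n then 1 else 0 := by
  rw [blockSum_rec]; exact netExp_bRec n q

/-- `b₀ = 41n` in the kit's shape. -/
theorem bRec_zero_cast (n : ℕ) : bRec n 0 = ((41 * n : ℕ) : ℤ) := by
  rw [bRec_zero]; push_cast; ring

/-- **Record-ray instance of the face kit**: a certificate accepted by `faceCheck 41 7 recLos recHis` is a class-type cover of
`bRec n` modulo `p` at every `(n, p)` of its window. -/
theorem rec_cover {c : FaceCert} (hc : faceCheck 41 7 recLos recHis c = true) {n p : ℕ} [Fact p.Prime]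
    (hm : c.win.Holds n p) : Cover (bRec n) p (coverOf 7 c) :=
  cover_of_faceCheck (b := bRec) bRec_zero_cast netExp_rec hc hm

end Summit.KontsevichZagierPeriods.Zeta5Search.RecordRayFaceKit
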